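import Mathlib
import Summits.Ventures.PercRepro2.Defs
import Summits.Ventures.PercRepro2.Independence
import Summits.Ventures.PercRepro2.Harris
import Summits.Ventures.PercRepro2.Graph
import Summits.Ventures.PercRepro2.Exploration
import Summits.Ventures.PercRepro2.Events
import Summits.Ventures.PercRepro2.FourFunctions
import Summits.Ventures.PercRepro2.Induced
import Summits.Ventures.PercRepro2.Frontier
import Summits.Ventures.PercRepro2.ObsIndependence
import Summits.Ventures.PercRepro2.BHK
import Summits.Ventures.PercRepro2.BHKEvents
import Summits.Ventures.PercRepro2.MultiSource
import Summits.Ventures.PercRepro2.OrderPreservation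
import Summits.Ventures.PercRepro2.SeedSet
import Summits.Ventures.PercRepro2.MultiSourceFun
import Summits.Ventures.PercRepro2.CrossRootT
import Summits.Ventures.PercRepro2.VdBKahn
import Summits.Ventures.PercRepro2.HullDefs
import Summits.Ventures.PercRepro2.CCTRootEdge
import Summits.Ventures.PercRepro2.CCTAvoidedEdge
import Summits.Ventures.PercRepro2.R1Rung
import Summits.Ventures.PercRepro2.CC2Rung
import Summits.Ventures.PercRepro2.PASubDefs
import Summits.Ventures.PercRepro2.PASub
import Summits.Ventures.PercRepro2.HalfN
import Summits.Ventures.PercRepro2.CCTLin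
import Summits.Ventures.PercRepro2.OneEdge
import Summits.Ventures.PercRepro2.GateDefs
import Summits.Ventures.PercRepro2.GateFrame

/-!
# The frame of the marker-edge rung: hull-frame positive association for two up-sets, and the
one-edge decomposition of the `e`-open avoidance at an edge `e = {a, w}` (blind cell PercRepro2,
typer-1; the lemmas behind `CC2_marker_edge`, mine-c g6 MINE-C.md §13.13; lead g11 16:50:33Z)

* **`hull_frame_pa_gen`**: for up-sets `𝓥₁, 𝓥₂` of vertex sets, the root-cluster events
  `{C(s) ∈ 𝓥ᵢ}` are positively associated given `R′ = R_T ∩ {K avoids B}` —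
  `P(C(s) ∈ 𝓥₁; R′) P(C(s) ∈ 𝓥₂; R′) ≤ P(C(s) ∈ 𝓥₁ ∩ 𝓥₂; R′) P(R′)` (the general form of
  `GateFrame.hull_frame_pa`: explore `K`, Harris in `G − W`, seed-set BHK with avoided set `{s} ∪ B`).
* The one-edge frame at `e = {a, w}` (`OneEdge.conn_update_true_iff`): with `W = {a, w}`,
  `R⁺ = {s ↛ T in ω⁺} = R_T ∩ (hitsS W ∩ hitsK W)ᶜ` (`Rplus_eq_marker_edge`); on `R⁺` the `e`-open
  marker event `X⁺ = {a ∈ C⁺(s)}` is `{S hits W}` (`Xplus_iff_hitsS`); `Y ⊆ Y⁺` (`Y_subset_Yplus`) and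
  `Y⁺ = Y` on `{S avoids W}` (`Yplus_iff_of_not_hitsS`).
-/

namespace Summit.Ventures.PercRepro2

namespace CCTMarker

open scoped Classical

variable {V : Type*} {E : Type*} [Fintype E] [DecidableEq E] [Fintype V] [DecidableEq V]
  {R : Type*} [Field R] [LinearOrder R] [IsStrictOrderedRing R]

/-! ## Hull-frame positive association for two up-sets -/

section HullGen

variable (p : E → R) (ends : E → Sym2 V) (s : V) (T B : Finset V)

omit [Fintype V] [DecidableEq V] in
/-- **Harris in `G − W`** for two up-sets of the root cluster. -/
lemma delClusterProb_mul_le_gen (hp : IsProbVec p) {𝓥₁ 𝓥₂ : Set (Set V)} (h₁ : IsUpperSet 𝓥₁)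
    (h₂ : IsUpperSet 𝓥₂) (W : Set V) :
    delClusterProb p ends s 𝓥₁ W * delClusterProb p ends s 𝓥₂ W ≤
      delClusterProb p ends s (𝓥₁ ∩ 𝓥₂) W := by
  unfold delClusterProb
  have hup : ∀ 𝓥 : Set (Set V), IsUpperSet 𝓥 →
      IsUpperSet {ω : Config E | cluster ends (delConfig ends W ω) s ∈ 𝓥} := by
    intro 𝓥 h𝓥 ω ω' hle hω
    exact h𝓥 (cluster_mono (Gate.delConfig_mono_config ends W hle) s) hω
  refine (prob_mul_prob_le_prob_inter hp (hup _ h₁) (hup _ h₂)).trans (le_of_eq ?_)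
  congr 1

/-- **Hull-frame positive association, general form**: for up-sets `𝓥₁, 𝓥₂`,
`P(C(s) ∈ 𝓥₁; R′) · P(C(s) ∈ 𝓥₂; R′) ≤ P(C(s) ∈ 𝓥₁ ∩ 𝓥₂; R′) · P(R′)` on `R′ = R_T ∩ {K avoids B}`. -/
theorem hull_frame_pa_gen (hp : IsProbVec p) {𝓥₁ 𝓥₂ : Set (Set V)} (h₁ : IsUpperSet 𝓥₁)
    (h₂ : IsUpperSet 𝓥₂) :
    prob p (clusterInEvent ends s 𝓥₁ ∩ (avoidAll ends s T ∩ (Gate.hitsK ends T B)ᶜ)) *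
        prob p (clusterInEvent ends s 𝓥₂ ∩ (avoidAll ends s T ∩ (Gate.hitsK ends T B)ᶜ)) ≤
      prob p (clusterInEvent ends s (𝓥₁ ∩ 𝓥₂) ∩ (avoidAll ends s T ∩ (Gate.hitsK ends T B)ᶜ)) *
        prob p (avoidAll ends s T ∩ (Gate.hitsK ends T B)ᶜ) := by
  set g₁ := delClusterProb p ends s 𝓥₁ with hg₁
  set g₂ := delClusterProb p ends s 𝓥₂ with hg₂
  set ind : Config E → R := (avoidAllT ends T ({s} ∪ B)).indicator 1 with hind
  have hmono : ∀ 𝓥 : Set (Set V), IsUpperSet 𝓥 →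
      Monotone (fun W => 1 - delClusterProb p ends s 𝓥 W) := by
    intro 𝓥 h𝓥 W W' h
    simp only
    linarith [delClusterProb_anti p hp ends s h𝓥 h]
  have hnn : ∀ 𝓥 : Set (Set V), ∀ W, 0 ≤ 1 - delClusterProb p ends s 𝓥 W :=
    fun 𝓥 W => sub_nonneg.2 (delClusterProb_le_one p hp ends s 𝓥 W)
  have key := bhk_multi p hp ends T (F₁ := fun W => 1 - g₁ W) (F₂ := fun W => 1 - g₂ W)
    (hmono _ h₁) (hmono _ h₂) (hnn _) (hnn _) ({s} ∪ B) ({s} ∪ B)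
  rw [Finset.inter_self, Finset.union_self] at key
  simp only [Pi.mul_apply] at key
  have hd : prob p (avoidAllT ends T ({s} ∪ B)) = expect p ind := prob_eq_expect_indicator p _
  have hq := Gate.expect_del_indicator_eq p ends s T B 𝓥₁
  have hyq := Gate.expect_del_indicator_eq p ends s T B 𝓥₂
  have hqy := Gate.expect_del_indicator_eq p ends s T B (𝓥₁ ∩ 𝓥₂)
  have e1 : expect p (fun ω => (1 - g₁ (clusterSet ends ω T)) * ind ω) =
      expect p ind - expect p (fun ω => g₁ (clusterSet ends ω T) * ind ω) := by
    rw [← expect_sub]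
    congr 1
    funext ω
    simp only [Pi.sub_apply]
    ring
  have e2 : expect p (fun ω => (1 - g₂ (clusterSet ends ω T)) * ind ω) =
      expect p ind - expect p (fun ω => g₂ (clusterSet ends ω T) * ind ω) := by
    rw [← expect_sub]
    congr 1
    funext ω
    simp only [Pi.sub_apply]
    ring
  have e3 : expect p (fun ω => (1 - g₁ (clusterSet ends ω T)) * (1 - g₂ (clusterSet ends ω T)) *
      ind ω) ≤
      expect p ind - expect p (fun ω => g₁ (clusterSet ends ω T) * ind ω) -
        expect p (fun ω => g₂ (clusterSet ends ω T) * ind ω) +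
        expect p (fun ω => delClusterProb p ends s (𝓥₁ ∩ 𝓥₂) (clusterSet ends ω T) * ind ω) := by
    have hpt : ∀ ω, (1 - g₁ (clusterSet ends ω T)) * (1 - g₂ (clusterSet ends ω T)) * ind ω ≤
        (ind - (fun ω => g₁ (clusterSet ends ω T) * ind ω) -
          (fun ω => g₂ (clusterSet ends ω T) * ind ω) +
          fun ω => delClusterProb p ends s (𝓥₁ ∩ 𝓥₂) (clusterSet ends ω T) * ind ω) ω := by
      intro ω
      simp only [Pi.sub_apply, Pi.add_apply]
      have hind0 : 0 ≤ ind ω := by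
        simp only [hind]
        exact Set.indicator_nonneg (fun _ _ => zero_le_one) ω
      have hH := delClusterProb_mul_le_gen p ends s hp h₁ h₂ (clusterSet ends ω T)
      rw [← hg₁, ← hg₂] at hH
      nlinarith [mul_le_mul_of_nonneg_right hH hind0]
    refine (expect_mono hp hpt).trans (le_of_eq ?_)
    rw [expect_add, expect_sub, expect_sub]
  rw [e1, e2] at key
  have key' := key.trans (mul_le_mul_of_nonneg_right e3 (prob_nonneg hp _))
  rw [hd, hq, hyq, hqy] at key'
  rw [← hd] at key'
  rw [Gate.avoidAllT_union_eq] at key' hd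
  rw [hd] at key' ⊢
  nlinarith [key']

end HullGen

/-! ## The one-edge frame at a marker edge `e = {a, w}` -/

section EdgeFrame

variable (ends : E → Sym2 V) (e : E) (s : V) (T : Finset V) (a b w : V)

omit [Fintype E] [Fintype V] in
/-- The `e`-open marker event: `a ∈ C⁺(s) ↔ S hits {a, w}`. -/
lemma Xplus_iff_hitsS (hends : ends e = s(a, w)) (ω : Config E) :
    Conn ends (Function.update ω e true) s a ↔ ω ∈ Gate.hitsS ends s {a, w} := by
  rw [OneEdge.conn_update_true_iff hends ω s a]
  simp only [Gate.hitsS, Set.mem_setOf_eq, Finset.mem_insert, Finset.mem_singleton,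
    exists_eq_or_imp, exists_eq_left]
  constructor
  · rintro (h | ⟨h, _⟩ | ⟨h, _⟩)
    · exact Or.inl h
    · exact Or.inl h
    · exact Or.inr h
  · rintro (h | h)
    · exact Or.inl h
    · exact Or.inr (Or.inr ⟨h, conn_refl _ _ _⟩)

omit [Fintype E] [Fintype V] [DecidableEq V] in
/-- `Y ⊆ Y⁺`: opening an edge keeps `b ∈ C(s)`. -/
lemma Y_subset_Yplus (ω : Config E) (h : Conn ends ω s b) :
    Conn ends (Function.update ω e true) s b :=
  conn_mono (OneEdge.le_update_true ω e) h

omit [Fintype E] [Fintype V] in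
/-- On `{S avoids {a, w}}`, `Y⁺ = Y`. -/
lemma Yplus_iff_of_not_hitsS (hends : ends e = s(a, w)) (ω : Config E)
    (hS : ω ∉ Gate.hitsS ends s {a, w}) :
    Conn ends (Function.update ω e true) s b ↔ Conn ends ω s b := by
  rw [OneEdge.conn_update_true_iff hends ω s b]
  simp only [Gate.hitsS, Set.mem_setOf_eq, Finset.mem_insert, Finset.mem_singleton,
    exists_eq_or_imp, exists_eq_left, not_or] at hS
  constructor
  · rintro (h | ⟨h, _⟩ | ⟨h, _⟩)
    · exact h
    · exact absurd h hS.1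
    · exact absurd h hS.2
  · exact fun h => Or.inl h

omit [Fintype E] [Fintype V] in
/-- **The `e`-open avoidance at `e = {a, w}`**: `R⁺ = R_T ∩ (S hits {a, w} ∧ K hits {a, w})ᶜ`
(`= Gate.gateEvent s T {a, w} {a, w}`). -/
lemma Rplus_eq_marker_edge (hends : ends e = s(a, w)) :
    PASub.Rplus ends e s T = Gate.gateEvent ends s T {a, w} {a, w} := by
  ext ω
  simp only [PASub.Rplus, Gate.gateEvent, Set.mem_setOf_eq, Set.mem_inter_iff, Set.mem_compl_iff,
    avoidAll]
  have hS : ω ∈ Gate.hitsS ends s {a, w} ↔ Conn ends ω s a ∨ Conn ends ω s w := by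
    simp [Gate.hitsS]
  have hK : ω ∈ Gate.hitsK ends T {a, w} ↔
      (∃ t ∈ T, Conn ends ω t a) ∨ ∃ t ∈ T, Conn ends ω t w := by
    simp only [Gate.hitsK, Set.mem_setOf_eq, Finset.mem_insert, Finset.mem_singleton,
      exists_eq_or_imp, exists_eq_left]
  rw [hS, hK]
  constructor
  · intro h
    refine ⟨fun t ht hc => h t ht (conn_mono (OneEdge.le_update_true ω e) hc), ?_⟩
    rintro ⟨hs, hk⟩
    rcases hk with ⟨t, ht, hta⟩ | ⟨t, ht, htw⟩
    · -- `K ∋ a`: `s ↔ a` directly or `s ↔ w ↔ a` through `e`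
      rcases hs with hsa | hsw
      · exact h t ht (conn_mono (OneEdge.le_update_true ω e) (conn_trans hsa (conn_symm hta)))
      · exact h t ht ((OneEdge.conn_update_true_iff hends ω s t).2
          (Or.inr (Or.inr ⟨hsw, conn_symm hta⟩)))
    · rcases hs with hsa | hsw
      · exact h t ht ((OneEdge.conn_update_true_iff hends ω s t).2
          (Or.inr (Or.inl ⟨hsa, conn_symm htw⟩)))
      · exact h t ht (conn_mono (OneEdge.le_update_true ω e) (conn_trans hsw (conn_symm htw)))
  · rintro ⟨hR, hno⟩ t ht hc
    rcases (OneEdge.conn_update_true_iff hends ω s t).1 hc with hc | ⟨hsa, hwt⟩ | ⟨hsw, hat⟩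
    · exact hR t ht hc
    · exact hno ⟨Or.inl hsa, Or.inr ⟨t, ht, conn_symm hwt⟩⟩
    · exact hno ⟨Or.inr hsw, Or.inl ⟨t, ht, conn_symm hat⟩⟩

end EdgeFrame

end CCTMarker

end Summit.Ventures.PercRepro2
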